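import Mathlib
import HarnessLib
import HarnessLib.Audit
import Summits.QuantumAdvantage.Statement
import Literature.Computability.Complexity.Counting
import HarnessLib.Audit.Status.Attr

/-!
Route: DyadicGap

DORMANT since 2026-08-26T12:42:38Z (reconciler: no traction for 7.1 d (last activity item-proof-filed at 2026-08-19T10:05:29Z); parked, not closed — `ledger route dormant route-QuantumAdvantage-DyadicGap --off` to reactivate) — unstaffed, not closed; items shared with open routes are served there. `ledger route dormant <id> --off` reactivates.

Route DyadicGap (idea card QuantumAdvantage/QuantumAdvantage/dyadic-valuation-gaps, absorbing the
retired sibling two-adic-window).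
Thesis X ("it suffices to show X"): there is a polynomial-time uniform, oracle-free family of
Toffoli+Hadamard circuits (tree gate set `toffoliH` = {H, X, CNOT, TOF}; all amplitudes real dyadic,
A = M/2^{h/2} with M = #positive − #negative paths, equivalently a ±1 character sum of a cubic phase
polynomial over F_2 — DawsonEtAl2005, Montanaro2017) whose DIAGONAL AMPLITUDES α_x =
⟨x0…0|U_{|x|}|x0…0⟩ are POLYNOMIALLY QUANTIZED (α_x ∈ 2^{-q}Z with 2^q ≤ (|x|+2)^c — the form a
certified 2-adic valuation ord_2 M_x ≥ h/2 − q takes) and whose sign language {x : α_x > 0} is not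
in BPP.
Lean (decl Target): ∃ (F : QCircuitFamily toffoliH) (c : ℕ), F.IsOracleFree ∧ F.IsUniform ∧ (∀ x, ∃
q k, 2^q ≤ (|x|+2)^c ∧ (F.circ |x|).mat (padInput x.get _) (padInput x.get _) = k/2^q) ∧ {x | 0 <
Re((F.circ |x|).mat (padInput x.get _) (padInput x.get _))} ∉
Literature.Computability.Complexity.BPP.
Assembly: QuantizedSignInBQP → Target → QuantumAdvantage, where QuantizedSignInBQP ("divisibility
manufactures gaps": a quantized amplitude is 0 or ≥ 2^{-q} in modulus, so the Hadamard test decides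
its sign with advantage 2^{-q-3} and BBBV majority amplification puts the sign language in BQP) is
the bridge; the assembly is one line (checked in the planner's Sketch.lean).

Rationale: WHY THIS LINE. The card reads BQP vs BPP through the 2-adic product formula for Toffoli+H path sums
A = M/2^e: bottom digits of M are classical (M mod 2^b in poly time for fixed b:
GopalanGuruswamiLipton2007,
Wan2007 Thm 1.1), the sign is quantum, and a CERTIFIED valuation ord_2 M_x >= e - O(log n) quantizes
alpha_x in 2^{-q}Z, turning the sign of an amplitude into a TOTAL language. Imports: p-adic
divisibility of
Boolean exponential sums (Ax1964, Katz1971, MorenoMoreno1995); gap-definable counting classes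
(FennerFortnowKurtz1994, FortnowRogers1999JCSS, deBeaudrap2015); exact synthesis over Z[1/sqrt2]
(GilesSelinger2013).
Planner's analysis (NOTES.md): (i) a window is TIGHTNESS of a circuit (e - ord_2 M = O(log)), not a
property of
the phase polynomial: Montanaro's H.D_f.H realisation has e = v and is classically samplable; (ii)
quantized-sign
languages sit in the band coEQP_{T+H} <= QSign <= LWPP cap BQP (items below): manufactured gaps are
exact-like
(LWPP = GLP[C], deBeaudrap2015 Thm 14); (iii) the card's win-win is a false dichotomy:
Maiorana-McFarland cubic
bent x.pi(y)+g(y) (Rothaus1976, Carlet2020) has charSum = +-2^k exactly, unbounded cubic rank and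
GL-hard Walsh
signs for one-way pi, yet is not circuit-tight; so K4 (rigidity) is dropped (false in structure, =
notX in
complexity); (iv) the only general certificates (Ax-Katz/Moreno-Moreno covers) are bounded by the
unitarity
exponent (H-wire chain monomials give mu ~ e) and certify windows only with O(log n) entangling
diagonal gates;
the sibling's '#P-hard interior' is trivial by dummy padding. What is worth banking: the bridge, the
sandwich,
and two sharp questions on whether quantization is MORE than exactness.
RANKED CRUXES. (2) QSignReducesToExact: (BQPWith toffoliH 0 <= BPP) -> every quantized sign language
in BPP.
With support ExactDequantOfQSignDequant (converse) it decides whether the mechanism adds anything to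
exactness.
Why it might fail: k/2^q carries an unknown integer k; zero-error extraction of sign(k) over
Z[1/sqrt2] is
obstructed by input-dependent junk (no exact amplitude amplification with dyadic gates);
deBeaudrap2015 sec.6,
BrassardHoyer1997. (3) QSignSubsetLPWPP: quantized sign languages lie in LPWPP (GapP value in {0,
M^t(|x|)}, fixed
M) = EQP_GL (deBeaudrap2015 Def 4, Prop 2, Thm 15). Why it might fail: the Lagrange indicator of k
in [1,B] on
nodes [-B,B] has odd denominators for B >= 2 (B=2: (1/24)Z) and every integer-coefficient polynomial
in the GapP
function k.2^m with node values {0,N} forces those primes into N; needs a non-interpolation idea.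
SUPPORTS. rank 4 QuantizedSignInBQP = the bridge (Hadamard test; controlled toffoliH gates EXACT in
Clifford+T:
CH = (1xR).CZ.(1xR^+), R = e^{-i pi/8} S H T H S^+; C3X with a clean ancilla; exact 2^{-Q-1} coin to
centre the
threshold; PolyMajority.exists_poly_amplified with eta = 2^{-Q-3} depending on |x|). rank 5
QSignSubsetLWPP
(FR99/deBeaudrap Prop 1 generalised from exact acceptance to quantized amplitudes: interpolate the
indicator of
k in [1,B], B = 2(|x|+2)^c, as an FP-integer polynomial in k.2^m in GapP; length-dependent
normaliser). rank 9:
HadamardTestFamily (exact statistics (1+Re a)/2), CoExactIsQuantizedSign (U = V^+ Z_0 V, amplitude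
1-2p),
ExactDequantOfQSignDequant, MagicWordValuation (carried from two-adic-window: Ax-Katz floor attained
with
equality along (CCZ.H^3)^k for all k; planner checked k <= 40 and found u_k = 2u_{k-1} - 16u_{k-3} +
64u_{k-4},
so u_k/2^{k-1} stays odd from 1,3,1,7), AxKatzCubicBoolean (Ax1964, p=2, d=3: 2^{ceil(v/3)} |
sum(-1)^f; Mathlib
has only Chevalley-Warning). Cite fact requested: 2-adic twin in P (Wan2007 Thm 1.1).
KILL CRITERIA. QSignReducesToExact proved => mechanism = exactness in disguise: close superseded
(exact-advantage
line), keep banked supports. QSignSubsetLPWPP proved + refuter census that all quantized uniform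
toffoliH families
in print are exact or Clifford-degenerate => same. Target is hypothesis-type
(SeparationPrerequisites), never
staffed for proof; notTarget contains EQP_{T+H} <= BPP and is not expected either.
NOT DECOMPOSED YET. Controlled-gate compiler + uniformity (inside the bridge); GapP closure under
polynomial
products (inside LWPP); any candidate family for Target (none known; by (iii) it must be
circuit-tight, i.e. the
circuit must know the hidden structure, which dyadic Toffoli+H exactness is not known to do);
certificates
beyond covers (Adolphson-Sperber Newton polyhedra).

Novelty: NOVELTY (searched 2026-08-15: card's own audit refs + `lit read arxiv:1509.07789` pp.5-6,13
(deBeaudrap2015 Def 2,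
Prop 1-2, Def 4, Thm 14-15), `lit read doi:10.1007/s10208-007-0245-y` pp.2-3 (Wan2007 Thm 1.1, GGL
ranges,
Ehrenfeucht-Karpinski), `lit frontier QuantumAdvantage --since 2020` (arXiv:2602.17647
pseudo-deterministic
quantum algorithms = the card's framing), `lit bridges QuantumAdvantage --cross any`, crossref 'LWPP
exact quantum
polynomial time' (BrassardHoyer1997, Rothe 1999); local searchd DOWN, OpenAlex/arXiv 429 - to be
re-run by the
novelty audit).
Nearest prior art. (1) The dictionary amplitude = +-1 character sum of a cubic over F_2:
DawsonEtAl2005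
(quant-ph/0408129), Montanaro2017 (1607.08473). (2) 2-adic twin in P: GopalanGuruswamiLipton2007,
Wan2007 Thm 1.1
(refuter audit: K1 KNOWN). (3) Divisibility: Ax1964, Katz1971, MorenoMoreno1995 (covers). (4) The
sandwich's two
ends are in print for EXACT computation: EQP <= LWPP (FortnowRogers1999JCSS Thm 3.x = deBeaudrap2015
Prop 1), EQP
<= LPWPP and LPWPP = EQP_GL, LWPP = GLP[C] (deBeaudrap2015 Prop 2, Thm 15, 14); Hadamard test (AJL,
tree file
HadamardTest.lean); exact Clifford+T synthesis of dyadic unitaries (GilesSelinger2013). (5) Bent/MM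
functions with
2-power Walsh values: Rothaus1976, Carlet2020.
Delta (not found in print): (a) 'polynomially quantized amplitude => BQP-decidable sign language' as
a
bridge lemma and the class QSign of manufactured-gap languages; (b) QSign <= LWPP (quantized, not
exact,
acc  [refs: 10.1007/s10208-007-0245-y`, 1509.07789, 2602.17647, arxiv:1509.07789, doi:10.1007/s10208-007-0245-y, Wan2007, BrassardHoyer1997, DawsonEtAl2005, Montanaro2017, GopalanGuruswamiLipton2007, Ax1964, Katz1971, MorenoMoreno1995, GilesSelinger2013, Rothaus1976, Carlet2020]

Barriers (technique_class: arithmetization, p-adic, counting-classes, exact-synthesis): technique_class (route): arithmetization, p-adic, counting-classes, exact-synthesis - a conditional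
bridge in shape (Target hypothesis-type).
Literature.Barriers.QuantumAdvantage.SeparationPrerequisites: APPLIES to Target (Target => summit =>
PP </= BPP, P != PP,
P != P^#P, P != PSPACE via SeparationPrerequisites.of_facts / not_PP_subset_BPP_of_witness); NOT
evaded - Target is
hypothesis-type and never staffed; the earned items (bridge, LWPP/LPWPP placement, magic-word
valuation, Ax-Katz) imply
no separation.
Literature.Barriers.QuantumAdvantage.Relativization (Relativization.not_relativizes_summit_shape)
and
Literature.Barriers.QuantumAdvantage.Algebrization
(Algebrization.not_isAlgebrizingSeparation_bqp_bpp): any proof of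
Target must be non-relativizing/non-algebrizing; the route's arithmetization is of the explicit GATE
LIST (path-sum
phase polynomial of a toffoliH circuit; an oracle gate has no phase polynomial), so the bridge and
the counting-class
items are non-black-box in kind, exactly as recorded for Dequantize - but they are
inclusions/structure, not the
separation, so nothing here claims to evade the barrier for Target. Crux QSignReducesToExact is an
implication
between two unrelativized inclusions and is untouched by both entries.
Literature.Barriers.QuantumAdvantage.TotalFunctionSpeedupLimit: informative, consistent -
quantization is what replaces
the promise (|alpha| in {0} u [2^-q,1]) to make the sign language TOTAL; in the black-box world
exactness already giv

Novelty grade: variant — Second route-review grade (refuter 3a2b8e1c, 2026-08-15), revising new-combination → VARIANT on new evidence. The route's delta (b) — QSign ⊆ LWPP for quantized amplitudes and the QUESTION QSign ⊆ LPWPP 'with the interpolation obstruction (odd Lagrange denominators)' — is settled on paper by known c (refuter refuter-rreview-route-QuantumAdvantage-G-3a2b8e1c-0, 2026-08-15T12:41:48Z; prior: doi:10.1016/s0022-0000(05)80024-8 FennerFortnowKurtz1994 JCSS 48 — Closure Property 5 p.123 (GapP closed under binom(f,k), k ≤ poly) + CP1/3/4, Cor 3.6 (held, read), arXiv:1509.07789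 deBeaudrap2015 Def 4, Prop 1–2 (EQP ⊆ LPWPP), Thm 14–15 (LWPP = GLP[C], LPWPP = EQP_GL) (read pp.6–8,13), FortnowRogers1999JCSS arXiv:cs/9811023 (EQP ⊆ LWPP via GapP amplitudes), arXiv:1111.5306 JordanKobayashiNagajNi)

History (route lifecycle, newest last):
- 2026-08-16T04:14:57Z · AUTO-CRUX (backfill): Target — hypotheses of the deciding theorem that nothing in the route derives are cruxes (operator:999:1085951)
- 2026-08-26T12:42:38Z · DORMANT — reconciler: no traction for 7.1 d (last activity item-proof-filed at 2026-08-19T10:05:29Z); parked, not closed — `ledger route dormant route-QuantumAdvantage-Dy (operator:999:2706323)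

sub-problem: QuantumAdvantage · status: dormant · opened planner-plancard-QuantumAdvantage-QuantumAdva-30a30a83-0 2026-08-15T10:59:10Z · rev 2 · ledger route-QuantumAdvantage-DyadicGap
GENERATED by the gate from the ledger (D-0016/17). Provers cite these decls: `theorem foo : Summit.QuantumAdvantage.QuantumAdvantage.Theses.DyadicGap.<Decl> := …` in Summits/QuantumAdvantage/QuantumAdvantage/Theorems/<Name>.lean.
-/

namespace Summit.QuantumAdvantage.QuantumAdvantage.Theses.DyadicGap

open scoped BigOperators Topology Manifold Classical MeasureTheory ProbabilityTheory Matrix InnerProductSpace ComplexConjugate ContinuousMap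
open Filter Set Function TopologicalSpace MeasureTheory

attribute [summit_statement] _root_.QuantumAdvantage

open Literature.QuantumAdvantage

/-- item stmt-QuantumAdvantage-1840 · crux (kind.auto-crux: conjecture-grade) · rank 0 · open · by planner
why it might fail: False if BQP = BPP; no candidate family is known (refuter audit K3); MM-bent analysis: a witness must be circuit-TIGHT (e - ord_2 M = O(log)), i.e. the circuit must know the hidden structure, which dyadic Toffoli+H exactness is not known to provide.
sources: DawsonEtAl2005, Montanaro2017, deBeaudrap2015, AaronsonGrewalEtAl2026PseudoDet, Literature.Barriers.QuantumAdvantage.SeparationPrerequisites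
[target] Thesis X of route DyadicGap (card dyadic-valuation-gaps): some poly-time uniform
oracle-free Toffoli+Hadamard family (tree gate set toffoliH) has polynomially QUANTIZED diagonal
amplitudes alpha_x = <x0..0|U_{|x|}|x0..0> in 2^{-q}Z, 2^q <= (|x|+2)^c (the shape of a certified
2-adic valuation window ord_2 M_x >= h/2 - q for the path-sum integer M_x), and its sign language {x
: alpha_x > 0} is not in BPP. Hypothesis-type (implies the summit via QuantizedSignInBQP;
SeparationPrerequisites applies); never staffed for proof. Sandwiched: coEQP_{toffoliH} </= BPP  ==>
X  ==>  BQP </= BPP (items CoExactIsQuantizedSign, QuantizedSignInBQP). -/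
@[route_item "route-QuantumAdvantage-DyadicGap", crux]
def Target : Prop :=
  ∃ (F : Literature.Computability.Cryptography.QCircuitFamily Literature.Computability.Cryptography.toffoliH) (c : ℕ), F.IsOracleFree ∧ @Literature.Computability.Cryptography.QCircuitFamily.IsUniform Literature.Computability.Cryptography.toffoliH (inferInstanceAs (Encodable Literature.Computability.Cryptography.ToffoliHOp)) F ∧ (∀ x : List Bool, ∃ (q : ℕ) (k : ℤ), 2 ^ q ≤ (x.length + 2) ^ c ∧ ((F.circ x.length).mat (Literature.Computability.Cryptography.padInput x.get (F.ancillas x.length)) (Literature.Computability.Cryptography.padInput x.get (F.ancillas x.length))) = (k : ℂ) / (2 : ℂ) ^ q) ∧ ({x : List Bool | 0 < ((F.circ x.length).mat (Literature.Computability.Cryptography.padInput x.get (F.ancillas x.length)) (Literature.Computability.Cryptography.padInput x.get (F.ancillas x.length))).re} : Language Bool) ∉ Literature.Computability.Complexity.BPP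

/-- item stmt-QuantumAdvantage-1842 · crux · rank 2 · open · by planner
why it might fail: An amplitude k/2^q carries an unknown integer k; zero-error extraction of sign(k) with dyadic gates (ring Z[1/sqrt2]) is obstructed by input-dependent junk registers (no exact amplitude amplification/discrimination for unknown k): the implication may be true yet out of reach.
sources: deBeaudrap2015, BrassardHoyer1997, FortnowRogers1999JCSS
[crux] 'Is quantization more than exactness?' If exact (zero-error) uniform Toffoli+H computation is
classically simulable (BQPWith toffoliH 0 <= BPP) then EVERY polynomially quantized uniform toffoliH
family has its amplitude-sign language in BPP. Together with the support ExactDequantOfQSignDequant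
(the converse, one line from CoExactIsQuantizedSign) this makes 'dequantize manufactured gaps'
EQUIVALENT to 'dequantize EQP_{T+H}', i.e. it decides whether the card's mechanism adds anything to
exact quantum computation. A proof most likely goes through a zero-error Toffoli+H (or BPP^{coEQP})
procedure extracting sign(k) from an amplitude k/2^q with unknown |k| <= 2^q. PROVED => route closes
superseded (kill criterion). Sources: deBeaudrap2015 sec. 2.2 and sec. 6 (SPP <= LPWPP <= LWPP
strictness open; 'SPP = LPWPP could be taken as evidence EQP = P'), BrassardHoyer1997
(exactification needs known structure), FortnowRogers1999JCSS. -/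
@[route_item "route-QuantumAdvantage-DyadicGap"]
def QSignReducesToExact : Prop :=
  @Literature.Computability.Cryptography.BQPWith Literature.Computability.Cryptography.toffoliH (inferInstanceAs (Encodable Literature.Computability.Cryptography.ToffoliHOp)) 0 ⊆ Literature.Computability.Complexity.BPP → ∀ (F : Literature.Computability.Cryptography.QCircuitFamily Literature.Computability.Cryptography.toffoliH) (c : ℕ), F.IsOracleFree → @Literature.Computability.Cryptography.QCircuitFamily.IsUniform Literature.Computability.Cryptography.toffoliH (inferInstanceAs (Encodable Literature.Computability.Cryptography.ToffoliHOp)) F → (∀ x : List Bool, ∃ (q : ℕ) (k : ℤ), 2 ^ q ≤ (x.length + 2) ^ c ∧ ((F.circ x.length).mat (Literature.Computability.Cryptography.padInput x.get (F.ancillas x.length)) (Literature.Computability.Cryptography.padInput x.get (F.ancillas x.length))) = (k : ℂ) / (2 : ℂ) ^ q) → ({x : List Bool | 0 < ((F.circ x.length).mat (Literature.Computability.Cryptography.padInput x.get (F.ancillas x.length)) (Literature.Computability.Cryptography.padInput x.get (F.ancillas x.length))).re} : Language Bool) ∈ Literature.Computability.Complexity.BPP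

/-- item stmt-QuantumAdvantage-1843 · crux · rank 3 · open · by planner
why it might fail: For B >= 2 the Lagrange indicator of [1,B] on nodes [-B,B] has odd denominators (B=2: coefficients in (1/24)Z), and an integer-coefficient polynomial in the GapP function k*2^m with node values {0,N} exists iff N clears them, so N = M^t with fixed M fails as B = poly(n) grows.
sources: deBeaudrap2015, FortnowRogers1999JCSS, FennerFortnowKurtz1994
[crux] Quantized sign languages lie in de Beaudrap's LPWPP: a GapP function g and a FIXED integer M
>= 1 with g(x) = M^{t(|x|)} (t poly-time from 1^n) on yes-instances and g(x) = 0 on no-instances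
(deBeaudrap2015 Def 4; Prop 2: EQP <= LPWPP, implicit in FortnowRogers1999JCSS; Thm 15: LPWPP =
EQP_GL, exact poly-time computation with invertible gates over a finite gate set). YES would say
manufactured gaps are literally exact computation up to unitarity; the planner's LWPP proof (item
QSignSubsetLWPP) does NOT give it: interpolating the indicator of k in [1,B] on the nodes [-B,B]
needs odd primes <= 2B in the normaliser. Informative either way; a disproof can only be
relativized/structural (exhibit the obstruction for all GapP-closure-built witnesses). -/
@[route_item "route-QuantumAdvantage-DyadicGap"]
def QSignSubsetLPWPP : Prop :=
  ∀ (F : Literature.Computability.Cryptography.QCircuitFamily Literature.Computability.Cryptography.toffoliH) (c : ℕ), F.IsOracleFree → @Literature.Computability.Cryptography.QCircuitFamily.IsUniform Literature.Computability.Cryptography.toffoliH (inferInstanceAs (Encodable Literature.Computability.Cryptography.ToffoliHOp)) F → (∀ x : List Bool, ∃ (q : ℕ) (k : ℤ), 2 ^ q ≤ (x.length + 2) ^ c ∧ ((F.circ x.length).mat (Literature.Computability.Cryptography.padInput x.get (F.ancillas x.length)) (Literature.Computability.Cryptography.padInput x.get (F.ancillas x.length))) = (k : ℂ) / (2 : ℂ)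 ^ q) → ∃ (M : ℕ) (t : ℕ → ℕ), 1 ≤ M ∧ Literature.Computability.Complexity.PolyTimeComputable Computability.unaryEncodeNat Computability.encodeNat t ∧ ∃ g ∈ Literature.Computability.Complexity.GapP, ∀ x : List Bool, (0 < ((F.circ x.length).mat (Literature.Computability.Cryptography.padInput x.get (F.ancillas x.length)) (Literature.Computability.Cryptography.padInput x.get (F.ancillas x.length))).re → g x = (M : ℤ) ^ t x.length) ∧ (¬ 0 < ((F.circ x.length).mat (Literature.Computability.Cryptography.padInput x.get (F.ancillas x.length)) (Literature.Computability.Cryptography.padInput x.get (F.ancillas x.length))).re → g x = 0)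

/-- item stmt-QuantumAdvantage-1844 · support · rank 4 · open · by planner
why it might fail: True on paper; as typed it needs the controlled toffoliH gates compiled EXACTLY into cliffordT inside a uniform family (CH = (1 x R) CZ (1 x R^+), R = e^{-i pi/8} S H T H S^+; C3X with a clean ancilla) and 1/poly-advantage amplification with eta depending on |x|.
sources: BennettBernsteinBrassardVazirani1997, GilesSelinger2013, DawsonEtAl2005
[support, the BRIDGE used by Assembly] 'Divisibility manufactures gaps': if a uniform oracle-free
toffoliH family has diagonal amplitudes alpha_x in 2^{-q}Z with 2^q <= (|x|+2)^c, then alpha_x > 0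
forces alpha_x >= (|x|+2)^{-c}, so the sign language {x : alpha_x > 0} is in BQP: (1)
HadamardTestFamily gives a uniform Clifford+T family accepting with probability exactly (1 +
alpha_x)/2; (2) AND the answer with an exact coin of bias 1 - 2^{-Q-1}, Q = ceil(c log2(|x|+2)) (Q+1
fresh H-ed ancillas, Toffolis), so yes-instances accept with prob >= 1/2 + 2^{-Q-3} and no-instances
with prob <= 1/2 - 2^{-Q-2}; (3) majority over poly many copies: PolyMajority.exists_poly_amplified
generalised to an advantage eta(|x|) = 2^{-Q-3} (PolyCopies.kernelProb_majF_ge is already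
per-input), then BQP_eq_BQPWith_holds. Not found in print as stated (refuter audit: 'a correct
two-liner' on paper); formal size: moderate (controlled-gate compiler + uniformity). Sources:
BennettBernsteinBrassardVazirani1997 Thm 4.13, GilesSelinger2013, tree files HadamardTest.lean,
PolyMajority.lean. -/
@[route_item "route-QuantumAdvantage-DyadicGap", crux]
def QuantizedSignInBQP : Prop :=
  ∀ (F : Literature.Computability.Cryptography.QCircuitFamily Literature.Computability.Cryptography.toffoliH) (c : ℕ), F.IsOracleFree → @Literature.Computability.Cryptography.QCircuitFamily.IsUniform Literature.Computability.Cryptography.toffoliH (inferInstanceAs (Encodable Literature.Computability.Cryptography.ToffoliHOp)) F → (∀ x : List Bool, ∃ (q : ℕ) (k : ℤ), 2 ^ q ≤ (x.length + 2) ^ c ∧ ((F.circ x.length).mat (Literature.Computability.Cryptography.padInput x.get (F.ancillas x.length)) (Literature.Computability.Cryptography.padInput x.get (F.ancillas x.length))) = (k : ℂ) / (2 : ℂ) ^ q) → ({x : List Bool | 0 < ((F.circ x.length).mat (Literature.Computability.Cryptography.padInput x.get (F.ancillas x.length)) (Literature.Computability.Cryptography.padInput x.get (F.ancillas x.length))).re}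 : Language Bool) ∈ Literature.Computability.Cryptography.BQP

/-- item stmt-QuantumAdvantage-1845 · support · rank 5 · open · by planner
why it might fail: Believed provable; as typed it needs GapP closure under polynomially many products and FP integer coefficients over the tree's exact-length-witness GapP, and the odd-Hadamard-count case handled by length-dependent case split.
sources: FennerFortnowKurtz1994, FortnowRogers1999JCSS, deBeaudrap2015
[support, structural ceiling] Quantized sign languages are in LWPP (FennerFortnowKurtz1994; de
Beaudrap Def 2: g in GapP, poly-time LENGTH-DEPENDENT h > 0, g(x) = h(|x|) on yes, 0 on no),
generalising EQP <= LWPP (FortnowRogers1999JCSS; deBeaudrap2015 Prop 1) from exact acceptance to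
quantized amplitudes; with deBeaudrap2015 Thm 14 (LWPP = GLP[C]) it says manufactured-gap languages
are exactly decidable by quasi-quantum (invertible, non-unitary) circuits and are low for PP. Proof
sketch: by register path sums G(x) := 2^{h_n/2} alpha_x = #positive - #negative paths is GapP (h_n =
Hadamard count of F.circ n, even w.l.o.g.: if h_n is odd all alpha_x of that length are 0 by
irrationality of sqrt2); K(x) := 2^{Q} alpha_x is an integer in [-B,B], B = 2^Q <= 2(|x|+2)^c, with
K*2^m = G (m = h_n/2 - Q; if m < 0 use G directly); the indicator of K in [1,B] is the Lagrange
polynomial I on nodes [-B,B]; D*I with D = lcm of denominators (divides (2B)!) is an integer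
polynomial of degree 2B, so g := 2^{2Bm} * D * I(K) is an FP-integer polynomial in G, hence GapP
(closure under sums and polynomially many products, FFK94), and equals h(n) := 2^{2Bm} D on
yes-instances, 0 otherwise. -/
@[route_item "route-QuantumAdvantage-DyadicGap"]
def QSignSubsetLWPP : Prop :=
  ∀ (F : Literature.Computability.Cryptography.QCircuitFamily Literature.Computability.Cryptography.toffoliH) (c : ℕ), F.IsOracleFree → @Literature.Computability.Cryptography.QCircuitFamily.IsUniform Literature.Computability.Cryptography.toffoliH (inferInstanceAs (Encodable Literature.Computability.Cryptography.ToffoliHOp)) F → (∀ x : List Bool, ∃ (q : ℕ) (k : ℤ), 2 ^ q ≤ (x.length + 2) ^ c ∧ ((F.circ x.length).mat (Literature.Computability.Cryptography.padInput x.get (F.ancillas x.length)) (Literature.Computability.Cryptography.padInput x.get (F.ancillas x.length))) = (k : ℂ) / (2 : ℂ) ^ q) → ∃ g ∈ Literature.Computability.Complexity.GapP, ∃ h : ℕ → ℕ, Literature.Computability.Complexity.PolyTimeComputable Computability.unaryEncodeNat Computability.encodeNat h ∧ ∀ x : List Bool, 0 < h x.length ∧ (0 < ((F.circ x.length).mat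 (Literature.Computability.Cryptography.padInput x.get (F.ancillas x.length)) (Literature.Computability.Cryptography.padInput x.get (F.ancillas x.length))).re → g x = h x.length) ∧ (¬ 0 < ((F.circ x.length).mat (Literature.Computability.Cryptography.padInput x.get (F.ancillas x.length)) (Literature.Computability.Cryptography.padInput x.get (F.ancillas x.length))).re → g x = 0)

/-- item stmt-QuantumAdvantage-17904 · support · rank 6 · open · by planner
[crux, hypothesis-type like its parent: refuters/grounders; not staffed for a direct proof] PIECE 1
of the derandomization cut of Target (strategist, Cruxes/Target/DyadicGapTargetSplit.lean): VERBATIM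
Target with `∉ BPP` replaced by `∉ Classes.P` — some poly-time uniform oracle-free Toffoli+H family
with polynomially QUANTIZED diagonal amplitudes alpha_x = <x0|U|x0> in 2^{-q}Z (2^q <= (|x|+2)^c)
has its sign language {x : alpha_x > 0} outside DETERMINISTIC polynomial time ('quantized Toffoli+H
signs beat P'). NECESSARY for the crux: Target → QSignNotInP
(DyadicGapTargetSplit.qSignNotInP_of_target, by the tree theorem P_subset_BPP_holds); strictly
weaker than it unless BPP ⊆ P (the converse is exactly piece 2 through IW97: target_of_subs; EHard →
(Target ↔ QSignNotInP)). Sandwiched like the parent: EQP_{toffoliH} ⊄ P ⟹ QSignNotInP ⟹ (LWPP ∩ BQP)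
⊄ P ⟹ P ≠ PSPACE (route items CoExactIsQuantizedSign, QSignSubsetLWPP; SeparationPrerequisites
applies one notch down). Birth skeleton Lines/dyadicgap_birth_QSignNotInP.lean (exact-first):
stub_coexact (= support CoExactIsQuantizedSign, provable) + stub_exactToffoliHNotInP (∃ L ∈ BQPWith
toffoliH 0, L ∉ P: open, no candidate language in prin -/
@[route_item "route-QuantumAdvantage-DyadicGap"]
def QSignNotInP : Prop :=
  ∃ (F : Literature.Computability.Cryptography.QCircuitFamily Literature.Computability.Cryptography.toffoliH) (c : ℕ), F.IsOracleFree ∧ @Literature.Computability.Cryptography.QCircuitFamily.IsUniform Literature.Computability.Cryptography.toffoliH (inferInstanceAs (Encodable Literature.Computability.Cryptography.ToffoliHOp)) F ∧ (∀ x : List Bool, ∃ (q : ℕ) (k : ℤ), 2 ^ q ≤ (x.length + 2) ^ c ∧ ((F.circ x.length).mat (Literature.Computability.Cryptography.padInput x.get (F.ancillas x.length)) (Literature.Computability.Cryptography.padInput x.get (F.ancillas x.length))) = (k : ℂ) / (2 : ℂ) ^ q) ∧ ({x : List Bool | 0 < ((F.circ x.length).mat (Literature.Computability.Cryptography.padInput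 x.get (F.ancillas x.length)) (Literature.Computability.Cryptography.padInput x.get (F.ancillas x.length))).re} : Language Bool) ∉ Literature.Computability.Complexity.Classes.P

-- TODO item stmt-QuantumAdvantage-17622 · support · rank 7 · open · by planner — BLOCKED: missing decl(s) Function.circuitSize; restate via `ledger route edit` once they land:
--   def YbEHard : Prop := ∃ L ∈ Literature.Computability.Complexity.E, ∃ ε : ℝ, 0 < ε ∧ ∀ᶠ n : ℕ in Filter.atTop, (2 : ℝ) ^ (ε * n) ≤ (L.circuitSize n : ℝ)

-- TODO item stmt-QuantumAdvantage-17905 · support · rank 9 · open · by planner — BLOCKED: missing decl(s) Function.circuitSize; restate via `ledger route edit` once they land: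
--   def TargetOfDerandomizationCut : Prop := (∃ (F : Literature.Computability.Cryptography.QCircuitFamily Literature.Computability.Cryptography.toffoliH) (c : ℕ), F.IsOracleFree ∧ @Literature.Computability.Cryptography.QCircuitFamily.IsUniform Literature.Computability.Cryptography.toffoliH (inferInstanceAs (Encodable Literature.Computability.C

/-- item stmt-QuantumAdvantage-1846 · support · rank 9 · open · by planner
sources: GilesSelinger2013, NielsenChuang2010
[support, glue for QuantizedSignInBQP] From a uniform oracle-free toffoliH family F build a uniform
oracle-free cliffordT family F' whose acceptance probability on x is EXACTLY (1 + Re<x0|U|x0>)/2: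
control ancilla c; H(c); controlled-U with every toffoliH gate replaced by its exact Clifford+T
controlled word (c-X = CNOT; c-CNOT = Toffoli = H.CCZ.H with the 7-T cczWord of
ReversibleCliffordT.lean; c-H = (1 x R) CZ (1 x R^+) with R = S H T H S^3 up to the cancelling
phases e^{-+i pi/8}; c-TOF = C3X via two Toffolis and one clean ancilla); H(c); X(c); SWAP(c, wire
0). Exactness of all words: GilesSelinger2013 (unitaries over Z[1/sqrt2, i] are exactly Clifford+T
with one ancilla). Statistics: tree HadamardTest.lean (hadamardTest_prob). -/
@[route_item "route-QuantumAdvantage-DyadicGap"]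
def HadamardTestFamily : Prop :=
  ∀ (F : Literature.Computability.Cryptography.QCircuitFamily Literature.Computability.Cryptography.toffoliH), F.IsOracleFree → @Literature.Computability.Cryptography.QCircuitFamily.IsUniform Literature.Computability.Cryptography.toffoliH (inferInstanceAs (Encodable Literature.Computability.Cryptography.ToffoliHOp)) F → ∃ F' : Literature.Computability.Cryptography.QCircuitFamily Literature.Computability.Cryptography.cliffordT, F'.IsOracleFree ∧ F'.IsUniform ∧ ∀ x : List Bool, F'.acceptProbOn 0 x = (1 + ((F.circ x.length).mat (Literature.Computability.Cryptography.padInput x.get (F.ancillas x.length)) (Literature.Computability.Cryptography.padInput x.get (F.ancillas x.length))).re) / 2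

/-- item stmt-QuantumAdvantage-1847 · support · rank 9 · open · by planner
sources: deBeaudrap2015, BrassardHoyer1997
[support, lower end of the sandwich] Every language decided with ZERO error by a uniform oracle-free
toffoliH family V (BQPWith toffoliH 0) is, up to complement, the sign language of an integrally
quantized family: F.circ n := V_n ; (H X H on wire 0) ; V_n reversed (H, X, CNOT, TOF are
self-inverse), so <x0|F|x0> = <psi|Z_0|psi> = 1 - 2 p_acc(x) = -1 if x in L, +1 otherwise.
Uniformity: list reversal and insertion are poly-time. Consequence (ExactDequantOfQSignDequant):
dequantizing all quantized sign languages dequantizes EQP over Toffoli+H. -/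
@[route_item "route-QuantumAdvantage-DyadicGap"]
def CoExactIsQuantizedSign : Prop :=
  ∀ L ∈ @Literature.Computability.Cryptography.BQPWith Literature.Computability.Cryptography.toffoliH (inferInstanceAs (Encodable Literature.Computability.Cryptography.ToffoliHOp)) 0, ∃ F : Literature.Computability.Cryptography.QCircuitFamily Literature.Computability.Cryptography.toffoliH, F.IsOracleFree ∧ @Literature.Computability.Cryptography.QCircuitFamily.IsUniform Literature.Computability.Cryptography.toffoliH (inferInstanceAs (Encodable Literature.Computability.Cryptography.ToffoliHOp)) F ∧ ∀ x : List Bool, ((F.circ x.length).mat (Literature.Computability.Cryptography.padInput x.get (F.ancillas x.length)) (Literature.Computability.Cryptography.padInput x.get (F.ancillas x.length))) = if x ∈ L then (-1 : ℂ) else 1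

/-- item stmt-QuantumAdvantage-1848 · support · rank 9 · open · by planner
sources: deBeaudrap2015
[support, converse of crux QSignReducesToExact] If every polynomially quantized uniform toffoliH
family has its sign language in BPP then BQPWith toffoliH 0 <= BPP: apply the hypothesis with c = 0
to the family of CoExactIsQuantizedSign (q = 0, k = -+1) to get L^c in BPP, and BPP is closed under
complement. One line given CoExactIsQuantizedSign and co BPP = BPP. -/
@[route_item "route-QuantumAdvantage-DyadicGap"]
def ExactDequantOfQSignDequant : Prop :=
  (∀ (F : Literature.Computability.Cryptography.QCircuitFamily Literature.Computability.Cryptography.toffoliH) (c : ℕ), F.IsOracleFree → @Literature.Computability.Cryptography.QCircuitFamily.IsUniform Literature.Computability.Cryptography.toffoliH (inferInstanceAs (Encodable Literature.Computability.Cryptography.ToffoliHOp)) F → (∀ x : List Bool, ∃ (q : ℕ) (k : ℤ), 2 ^ q ≤ (x.length + 2) ^ c ∧ ((F.circ x.length).mat (Literature.Computability.Cryptography.padInput x.get (F.ancillas x.length)) (Literature.Computability.Cryptography.padInput x.get (F.ancillas x.length))) = (k : ℂ) / (2 : ℂ) ^ q) → ({x : List Bool | 0 < ((F.circ x.length).mat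 (Literature.Computability.Cryptography.padInput x.get (F.ancillas x.length)) (Literature.Computability.Cryptography.padInput x.get (F.ancillas x.length))).re} : Language Bool) ∈ Literature.Computability.Complexity.BPP) → @Literature.Computability.Cryptography.BQPWith Literature.Computability.Cryptography.toffoliH (inferInstanceAs (Encodable Literature.Computability.Cryptography.ToffoliHOp)) 0 ⊆ Literature.Computability.Complexity.BPP

/-- item stmt-QuantumAdvantage-1849 · support · rank 9 · open · by planner
sources: Ax1964, Katz1971, DawsonEtAl2005, Montanaro2017
[support, carried from the retired sibling card two-adic-window: 'Ax-Katz is tight along the magic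
word'] Let S be the 8x8 integer matrix S_{ab} = (-1)^{a.b + a_0 a_1 a_2} (indices a, b in F_2^3), so
that (CCZ . H^{x3})^k = 2^{-3k/2} S^k and u_k := (S^k)_{00} = 2^{3k/2} <000|(CCZ.H^{x3})^k|000> is
the path-sum integer of the k-th power of the magic word (h = 3k Hadamards, h' = 3k - 3 free path
variables, Ax-Katz floor ceil(h'/3) = k - 1). Claim: ord_2(u_k) = k - 1 EXACTLY for every k >= 1
(the sibling checked k <= 15; the planner checked k <= 40: u = 1, 6, 4, 56, 80, 480, 320, 2944,
...). Proof route found by the planner: the sequence obeys u_k = 2 u_{k-1} - 16 u_{k-3} + 64 u_{k-4}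
(verify the vector identity S^4 e_0 = 2 S^3 e_0 - 16 S e_0 + 64 e_0 by computation; char poly of S
is x^8 - 2x^7 - 16x^6 + 48x^5 - 384x^3 + 1024x^2 + 1024x - 4096), hence w_k := u_k / 2^{k-1}
satisfies w_k = w_{k-1} - 2 w_{k-3} + 4 w_{k-4} with w_1..w_4 = 1, 3, 1, 7, so w_k is odd by
induction. Calibrates the '2-adic magic rate': generic magic circuits sit AT the Ax-Katz floor,
maximally far from a valuation window. -/
@[route_item "route-QuantumAdvantage-DyadicGap"]
def MagicWordValuation : Prop :=
  ∀ k : ℕ, 1 ≤ k → (2 : ℤ) ^ (k - 1) ∣ ((Matrix.of fun a b : Fin 3 → Bool => (-1 : ℤ) ^ ((Finset.univ.filter fun i : Fin 3 => a i && b i).card + (if a 0 && a 1 && a 2 then 1 else 0))) ^ k) (fun _ => false) (fun _ => false) ∧ ¬ (2 : ℤ) ^ k ∣ ((Matrix.of fun a b : Fin 3 → Bool => (-1 : ℤ) ^ ((Finset.univ.filter fun i : Fin 3 => a i && b i).card + (if a 0 && a 1 && a 2 then 1 else 0))) ^ k) (fun _ => false) (fun _ => false)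

/-- item stmt-QuantumAdvantage-1850 · support · rank 9 · open · by planner
sources: Ax1964, Katz1971, MorenoMoreno1995, Mceliece2002
[support, Literature-grade fact the 2-adic line rests on] Ax's theorem for p = 2, d = 3 in
character-sum form: for every polynomial f over F_2 in v variables of total degree <= 3,
2^{ceil(v/3)} divides sum_y (-1)^{f(y)} (= 2 N(f) - 2^v with N(f) = 0 mod 2^{ceil(v/3) - 1};
equivalently McEliece: weights in RM(3, v) are divisible by 2^{ceil(v/3) - 1}). Tight: f = y_1 y_2
y_3 gives 6. Mathlib has only Chevalley-Warning (char_dvd_card_solutions_of_sum_lt). Elementary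
proofs for p = 2 exist (expand (-1)^f = prod over monomials of (1 - 2 m(y)) and count 2-powers, or
McEliece's); Moreno-Moreno's covering refinement (2^{mu} | sum, mu = minimal number of monomials
covering all occurring variables) is the certificate technology discussed in the route rationale. -/
@[route_item "route-QuantumAdvantage-DyadicGap"]
def AxKatzCubicBoolean : Prop :=
  ∀ (v : ℕ) (f : MvPolynomial (Fin v) (ZMod 2)), f.totalDegree ≤ 3 → (2 : ℤ) ^ ((v + 2) / 3) ∣ ∑ y : Fin v → ZMod 2, (if MvPolynomial.eval y f = 0 then (1 : ℤ) else -1)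

/-- item stmt-QuantumAdvantage-1841 · assembly · rank 1 · closed · proved by Summit.QuantumAdvantage.QuantumAdvantage.Theorems.DyadicGap.Assembly_proof @ 27fc3325a297 (prover) · by planner
sources: DawsonEtAl2005
[assembly] QuantizedSignInBQP -> Target -> QuantumAdvantage: take the family F, c of Target; its
sign language is in BQP by the bridge and not in BPP by hypothesis; one line (checked in the
planner's Sketch.lean). -/
@[route_item "route-QuantumAdvantage-DyadicGap"]
def Assembly : Prop :=
  QuantizedSignInBQP → Target → QuantumAdvantage

-- `Assembly` holds: proved by `Summit.QuantumAdvantage.QuantumAdvantage.Theorems.DyadicGap.Assembly_proof` @ 27fc3325a297 (its module imports this route file, so no `_holds` link can be stated here).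

/-! D-0027 §2.1 — DECIDING THEOREM (planner-authored via `route open/edit --closes-file`; by planner-rbadge-QuantumAdvantage-DyadicGap-c4850832-g2-0 2026-08-15T16:09:42Z):
its hypotheses are this route's items and its conclusion the sub-problem Statement (glue_lint), and it elaborates with this file. -/

@[closes "route-QuantumAdvantage-DyadicGap"] theorem closes (h₁ : QuantizedSignInBQP) (h₂ : Target) : _root_.QuantumAdvantage := by
  obtain ⟨F, c, hof, hunif, hquant, hnot⟩ := h₂
  exact ⟨_, h₁ F c hof hunif hquant, hnot⟩

end Summit.QuantumAdvantage.QuantumAdvantage.Theses.DyadicGap
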